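import Summits.BirchSwinnertonDyer.BirchSwinnertonDyer.Theorems.ClassRecordThreeCornerAtThreeShimuraFamilySupplyFromLabels
import Summits.BirchSwinnertonDyer.BirchSwinnertonDyer.Theorems.ClassRecordThreeCornerAtThreeShimuraFamilyProducers
import HarnessLib

/-!
# SINGLE-DATUM local producers for tam3-p1's GROSS-keyed (P2) assembly on a Shimura frame: Gross 6.2 (1) `hSel` (Kummer at the
# finite places off `n`) and Jetchev 4.9 `hstrq` (STRINGENT at the bad places over the exempted split prime `q ∉ S`) for EVERY datum
# `d` with `d.y = ys n`, from `LabelsAt` + `LabelB6` (cell `bsd-stepL`, seat `bsd-stepL-corner3-p2` g8 = WIDTH-LEVER lane B;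
# `--supports stmt-BirchSwinnertonDyer-21420 --as helper`)

WHY (tam3-p1 g13, STATUS 04:14Z: the END-GAME composition `Koly.levelSupplyAt_three_of_labels_of_familyProducers` displays five
∀-datum producers; this file supplies two of them). Lane B's tower-form producers p600152 (`kolyvaginClass_familyData_mem_selmerLocalKer`,
Gross 6.2 (1) at every finite `𝔳 ∤ m`: good places by Milne I.3.8, inert `S`-places by (R1), split `N⁺`-places by the (B6) receptacle)
and p601311 (`localization_kolyvaginClass_familyData_mem_stringentFamily`, Jetchev 4.9 at a bad split place over `q ∉ S`) are run on
the EXTENSION of an arbitrary datum `d` (`d.y = ys n`) to a divisor family (p-Producers `exists_familyData_extension`), with the labels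
in datum form read off `LabelsAt` (p601736 `familyLabels_of_labelsAt`) and the receptacle + `p ∤ #E(ℚ)_tors` read off `LabelB6`
(p601736 `familyReceptacle_of_labelB6`); admissibility is taken in the composition's ∀-datum shape `hA`.

RESULTS (namespace `Summit.BirchSwinnertonDyer.BirchSwinnertonDyer.Theorems.ShimuraWalk`):
* `natCast_not_mem_asIdeal_of_prime_mem` — a place over the prime `q` contains no `m` prime to `q`.
* `kolyvaginClass_familyData_mem_selmerLocalKer_of_labelsAt` — `hSel` VERBATIM (∀ M n d, 1 ≤ M → d.y = ys n → … → ∀ 𝔳 ∌ n, c_M(d) ∈ Sel_𝔳).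
* `localization_kolyvaginClass_familyData_mem_stringentFamily_of_labelsAt` — `hstrq` at every BAD place `v ∋ q` (`q ∣ N`, `q ∉ S`
  split): `loc_v c_k(d) ∈ stringentFamily`; the composition calls it in its `t ≥ 1` branch, where `q ∣ N` (`3 ∣ c_q`) and the
  carrier places are bad.

HONEST FRAMING. Helper lemmas toward crux 21420 `CornerAtThreeW` (line `Lines/inert.lean` r7, stub `stub_upper3_residualMulti`) and
19109; nothing about BSD, `J₃`, or any divisibility of a Heegner point is asserted; no stub is discharged; no item closes; 0 classes
move (T7). `K : Type`. References: [cite: GrossLMS1991, §6 Prop. 6.2 (1)] [cite: Jetchev2008, Prop. 4.6, Cor. 4.8, Prop. 4.9]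
[cite: GrossZagier1986, III (3.1)] [cite: MilneADT2006, Ch. I Prop. 3.8]. Axioms: `propext`, `Classical.choice`, `Quot.sound`.
-/

set_option autoImplicit false
set_option linter.dupNamespace false

noncomputable section

open scoped Classical

namespace Summit.BirchSwinnertonDyer.BirchSwinnertonDyer.Theorems.ShimuraWalk

open WeierstrassCurve Field NumberField IsDedekindDomain Finset
  Literature.NumberTheory.EllipticCurves Literature.NumberTheory.GaloisRepresentations
  Literature.NumberTheory.EllipticCurves.KolyvaginCocycle
  Literature.NumberTheory.EllipticCurves.RingClassField
  Literature.NumberTheory.EllipticCurves.ModularForms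
  Summit.BirchSwinnertonDyer.Rank1Residual.X11b
  Summit.BirchSwinnertonDyer.Rank1Residual.JET
  Summit.BirchSwinnertonDyer.BirchSwinnertonDyer.Theorems
  Literature.NumberTheory.EllipticCurves.ShimuraCMFamily

variable {K : Type} [Field K] [NumberField K] {W : WeierstrassCurve ℚ} {ι : K →+* ℂ}

/-! ## §1 Places over `q` -/

omit [NumberField K] in
/-- A finite place containing the rational prime `q` contains no natural number all of whose prime factors differ from `q`
(`m ≠ 0`): Bezout. [folklore] -/
theorem natCast_not_mem_asIdeal_of_prime_mem (v : HeightOneSpectrum (𝓞 K)) {q : ℕ} (hq : q.Prime)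
    (hqv : (q : 𝓞 K) ∈ v.asIdeal) {m : ℕ} (hm0 : m ≠ 0) (hm : ∀ ℓ ∈ m.primeFactors, ℓ ≠ q) :
    (m : 𝓞 K) ∉ v.asIdeal := by
  intro hmv
  have hqm : ¬ q ∣ m := fun h ↦ hm q (Nat.mem_primeFactors.mpr ⟨hq, h, hm0⟩) rfl
  have hcop : IsCoprime (m : ℤ) (q : ℤ) :=
    Nat.isCoprime_iff_coprime.mpr (Nat.Coprime.symm ((Nat.Prime.coprime_iff_not_dvd hq).mpr hqm))
  obtain ⟨a, b, hab⟩ := hcop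
  have h1 : (1 : 𝓞 K) ∈ v.asIdeal := by
    have h := congrArg (Int.cast : ℤ → 𝓞 K) hab
    push_cast at h
    rw [← h]
    exact v.asIdeal.add_mem (v.asIdeal.mul_mem_left _ hmv) (v.asIdeal.mul_mem_left _ hqv)
  exact v.isPrime.ne_top ((Ideal.eq_top_iff_one _).mpr h1)

/-! ## §2 `hSel`: Gross 6.2 (1) for every datum -/

set_option maxHeartbeats 800000 in
/-- **The producer `hSel`** (Gross 6.2 (1): `c_M(d) ∈ Sel_𝔳` at every finite `𝔳 ∤ n`) for EVERY datum `d` with `d.y = ys n` on a Shimura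
frame `(W, N, K, S)` carrying `LabelsAt` and `LabelB6` at the primes of `N` outside `S`, `E[p]` irreducible, admissible `E(K[m])` (the
composition's `hA`): tam3-p1's binder shape verbatim. p600152 on the extension of `d`. [cite: GrossLMS1991, §6 Prop. 6.2 (1)]
[cite: Jetchev2008, Prop. 4.6, Cor. 4.8] [cite: MilneADT2006, Ch. I Prop. 3.8] -/
theorem kolyvaginClass_familyData_mem_selmerLocalKer_of_labelsAt {N : ℕ} [NeZero N] [W.IsElliptic] [W.IsGloballyMinimal]
    (hK : IsImaginaryQuadratic K) (ι : K →+* ℂ) (hN : W.conductorNorm ℤ = N) {p : ℕ} [Fact p.Prime]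
    (Dt : ModularParametrizationData W N) [∀ j : ℕ, NumberField (ringClassField K ι j)] (hirr : W.HasIrreducibleModPGaloisRep p)
    {S : Finset ℕ}
    (hin : ∀ ℓ ∈ S, ℓ.Prime ∧ ℓ ∣ N ∧ ¬ ℓ ^ 2 ∣ N ∧
      ((Ideal.span {(ℓ : ℤ)}).primesOver (𝓞 K)).ncard = 1 ∧ ¬ (ℓ : ℤ) ∣ NumberField.discr K)
    (hsp : ∀ ℓ : ℕ, ℓ.Prime → ℓ ∣ N → ℓ ∉ S → ((Ideal.span {(ℓ : ℤ)}).primesOver (𝓞 K)).ncard = 2)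
    (ys : (m : ℕ) → (W.baseChange (ringClassField K ι m)).toAffine.Point)
    {yK : (W.baseChange K).toAffine.Point} {ε : ℤ} (hL : LabelsAt W N K ι yK ys ε)
    (hB6 : LabelB6 ι W N (N.primeFactors.filter (· ∉ S)) ys)
    (hA : ∀ (m : ℕ) (dm : KolyvaginFamilyData W K ι m), dm.y = ys m → Squarefree m →
      (∀ q ∈ m.primeFactors, IsKolyvaginPrime N W K p q) →
      ∀ j : ℕ, IsAdmissible (absoluteGaloisGroup K) dm.pointsSubgroup ((p ^ j : ℕ) : ℤ))
    (M n : ℕ) (d : KolyvaginFamilyData W K ι n) (hM : 1 ≤ M) (hdy : d.y = ys n) (hn : Squarefree n)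
    (hKol : ∀ q ∈ n.primeFactors, IsKolyvaginPrime N W K p q ∧ FrobEqFrobInfty W K (p ^ M) q)
    (𝔳 : HeightOneSpectrum (𝓞 K)) (h𝔳 : (n : 𝓞 K) ∉ 𝔳.asIdeal) :
    d.kolyvaginClass (Fact.out : p.Prime) M ∈ selmerLocalKer (W.baseChange K) (𝔳.adicCompletion K) ((p ^ M : ℕ) : ℤ) := by
  have hp : p.Prime := Fact.out
  have hn0 : n ≠ 0 := hn.ne_zero
  have hguard : ∀ q ∈ n.primeFactors, ¬ q ∣ N ∧ (Ideal.span {(q : 𝓞 K)}).IsPrime :=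
    fun q hq ↦ ⟨(hKol q hq).1.2.1, (hKol q hq).1.2.2.2.2.1⟩
  obtain ⟨D, hDd, hDy⟩ := exists_familyData_extension (W := W) hK ι hn (fun q hq ↦ (hguard q hq).2) ys d hdy
  subst hDd
  obtain ⟨hB4d, -, -⟩ := familyLabels_of_labelsAt (W := W) hn hguard ys hL D hDy
  obtain ⟨hcopT, hrecQ⟩ := familyReceptacle_of_labelB6 (W := W) hK ι p hirr hn hguard ys hB6 D hDy
  have hcop : IsCoprime ((p ^ M : ℕ) : ℤ) (W.torsionOrder : ℤ) := by
    rw [Nat.cast_pow]; exact hcopT.pow_left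
  have hA' : ∀ (m : ℕ) (hm : m ∣ n), IsAdmissible (absoluteGaloisGroup K) (D m hm).pointsSubgroup ((p ^ M : ℕ) : ℤ) :=
    fun m hm ↦ hA m (D m hm) (hDy m hm) (hn.squarefree_of_dvd hm)
      (fun q hq ↦ (hKol q (Nat.primeFactors_mono hm hn0 hq)).1) M
  have hrec : ∀ (q : ℕ), q.Prime → q ∣ N → q ∉ S → ∀ (m : ℕ) (hm : m ∣ n)
      (γ : ringClassField K ι m ≃ₐ[ℚ] ringClassField K ι m) (v : HeightOneSpectrum (𝓞 K)),
      ((q : ℕ) : 𝓞 K) ∈ v.asIdeal →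
        (W.torsionOrder : ℤ) • pointsMap (W.baseChange K) (v.adicCompletion K)
            ((D m hm).toGeomPoints (pointGalHom W (ringClassField K ι m) γ (D m hm).y)) ∈
          E0Receptacle (W.baseChange K) v ∧
        ∀ (ℓ : ℕ) (hℓ : ℓ ∈ m.primeFactors)
          (hle : ringClassField K ι (m / ℓ) ≤ ringClassField K ι m),
          (W.torsionOrder : ℤ) • pointsMap (W.baseChange K) (v.adicCompletion K)
              ((D m hm).toGeomPoints (pointGalHom W (ringClassField K ι m) γ
                (WeierstrassCurve.Affine.Point.map (W' := W)
                  ((RingClassField.inclusion ι hle).restrictScalars ℚ)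
                  (D (m / ℓ) ((Nat.div_dvd_of_dvd (Nat.dvd_of_mem_primeFactors hℓ)).trans hm)).y))) ∈
            E0Receptacle (W.baseChange K) v := by
    intro q hqp hqN hqS m hm γ v hqv
    have hqQ : q ∈ N.primeFactors.filter (· ∉ S) :=
      Finset.mem_filter.mpr ⟨Nat.mem_primeFactors.mpr ⟨hqp, hqN, NeZero.ne N⟩, hqS⟩
    exact hrecQ q hqQ hqp hqN (hsp q hqp hqN hqS) m hm γ v hqv
  exact kolyvaginClass_familyData_mem_selmerLocalKer hK ι hN hp hM Dt hin hn hKol D hB4d hcop hrec hA' n dvd_rfl 𝔳 h𝔳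

/-! ## §3 `hstrq`: Jetchev 4.9 for every datum at the bad places over `q` -/

set_option maxHeartbeats 800000 in
/-- **The producer `hstrq`** (Jetchev Prop. 4.9: `loc_v c_k(d) ∈ H¹_{𝓕⁰}(K_v)` at a bad place `v` over the exempted split prime
`q ∉ S`, `q ∣ N`) for EVERY datum `d` with `d.y = ys n` (`n` on Gross–Kolyvagin primes with (3.2) modulo `p^k`, `k ≥ 1`) on a
Shimura frame carrying `LabelsAt` and `LabelB6`, `E[p]` irreducible, admissible `E(K[m])`. The composition calls it in its `t ≥ 1`
branch, where `q ∣ N` and the carrier places are bad. p601311 on the extension of `d`; `v ∌ n` since the primes of `n` are prime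
to `N`. [cite: Jetchev2008, Prop. 4.9, Cor. 4.8] [cite: GrossZagier1986, III (3.1)] -/
theorem localization_kolyvaginClass_familyData_mem_stringentFamily_of_labelsAt {N : ℕ} [NeZero N] [W.IsElliptic]
    [W.IsGloballyMinimal]
    (hK : IsImaginaryQuadratic K) (ι : K →+* ℂ) {p : ℕ} [Fact p.Prime]
    (Dt : ModularParametrizationData W N) [∀ j : ℕ, NumberField (ringClassField K ι j)] (hirr : W.HasIrreducibleModPGaloisRep p)
    {S : Finset ℕ}
    (hsp : ∀ ℓ : ℕ, ℓ.Prime → ℓ ∣ N → ℓ ∉ S → ((Ideal.span {(ℓ : ℤ)}).primesOver (𝓞 K)).ncard = 2)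
    (ys : (m : ℕ) → (W.baseChange (ringClassField K ι m)).toAffine.Point)
    {yK : (W.baseChange K).toAffine.Point} {ε : ℤ} (hL : LabelsAt W N K ι yK ys ε)
    (hB6 : LabelB6 ι W N (N.primeFactors.filter (· ∉ S)) ys)
    (hA : ∀ (m : ℕ) (dm : KolyvaginFamilyData W K ι m), dm.y = ys m → Squarefree m →
      (∀ q ∈ m.primeFactors, IsKolyvaginPrime N W K p q) →
      ∀ j : ℕ, IsAdmissible (absoluteGaloisGroup K) dm.pointsSubgroup ((p ^ j : ℕ) : ℤ))
    (q : ℕ) [Fact q.Prime] (hqN : q ∣ N) (hqS : q ∉ S)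
    (k : ℕ) (hn' : ((p ^ k : ℕ) : ℤ) ≠ 0) (n : ℕ) (d : KolyvaginFamilyData W K ι n) (hk : 1 ≤ k) (hdy : d.y = ys n)
    (hn : Squarefree n)
    (hKol : ∀ q' ∈ n.primeFactors, IsKolyvaginPrime N W K p q' ∧ FrobEqFrobInfty W K (p ^ k) q')
    (v : HeightOneSpectrum (𝓞 K)) (hqv : ((q : ℕ) : 𝓞 K) ∈ v.asIdeal) (hbad : ¬ (W.baseChange K).HasGoodReductionAt v) :
    galoisCohomology.localization ((W.baseChange K).torsionGaloisModule ((p ^ k : ℕ) : ℤ)) (Sum.inr v) 1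
        (d.kolyvaginClass (Fact.out : p.Prime) k) ∈ stringentFamily W K hn' (Sum.inr v) := by
  have hp : p.Prime := Fact.out
  have hq : q.Prime := Fact.out
  have hn0 : n ≠ 0 := hn.ne_zero
  have hguard : ∀ q' ∈ n.primeFactors, ¬ q' ∣ N ∧ (Ideal.span {(q' : 𝓞 K)}).IsPrime :=
    fun q' hq' ↦ ⟨(hKol q' hq').1.2.1, (hKol q' hq').1.2.2.2.2.1⟩
  -- `v ∌ n`: the primes of `n` are prime to `N`, `q ∣ N`
  have hnv : (n : 𝓞 K) ∉ v.asIdeal :=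
    natCast_not_mem_asIdeal_of_prime_mem v hq hqv hn0 fun ℓ hℓ hℓq ↦ (hguard ℓ hℓ).1 (hℓq ▸ hqN)
  obtain ⟨D, hDd, hDy⟩ := exists_familyData_extension (W := W) hK ι hn (fun q' hq' ↦ (hguard q' hq').2) ys d hdy
  subst hDd
  obtain ⟨hB4d, -, -⟩ := familyLabels_of_labelsAt (W := W) hn hguard ys hL D hDy
  obtain ⟨hcopT, hrecQ⟩ := familyReceptacle_of_labelB6 (W := W) hK ι p hirr hn hguard ys hB6 D hDy
  have hcop : IsCoprime ((p ^ k : ℕ) : ℤ) (W.torsionOrder : ℤ) := by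
    rw [Nat.cast_pow]; exact hcopT.pow_left
  have hA' : ∀ (m : ℕ) (hm : m ∣ n), IsAdmissible (absoluteGaloisGroup K) (D m hm).pointsSubgroup ((p ^ k : ℕ) : ℤ) :=
    fun m hm ↦ hA m (D m hm) (hDy m hm) (hn.squarefree_of_dvd hm)
      (fun q' hq' ↦ (hKol q' (Nat.primeFactors_mono hm hn0 hq')).1) k
  have hq2 := hsp q hq hqN hqS
  have hqQ : q ∈ N.primeFactors.filter (· ∉ S) :=
    Finset.mem_filter.mpr ⟨Nat.mem_primeFactors.mpr ⟨hq, hqN, NeZero.ne N⟩, hqS⟩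
  exact localization_kolyvaginClass_familyData_mem_stringentFamily hK ι hp hk hn' Dt hn hKol D hB4d hA' dvd_rfl q hqN hq2
    v hqv hnv hbad hcop (fun γ ↦ hrecQ q hqQ hq hqN hq2 n dvd_rfl γ v hqv)

end Summit.BirchSwinnertonDyer.BirchSwinnertonDyer.Theorems.ShimuraWalk

end
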